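import Literature.Computability.QuantumComplexity.JonesSamplerAnalysis
import HarnessLib

/-!
# The AJL sampler with a margin: acceptance `≥ 5/6` / `≤ 1/6` for `K ≥ 192·prec²`

Topic `Literature/Computability/QuantumComplexity`; sequel of `JonesSamplerAnalysis.lean`, a step in the
discharge of `ajl_jonesApproxProblem_mem_PromiseBQP`. The completeness/soundness bounds of the
sampler are re-derived with twice as many trials, leaving room `1/6` for the gate-approximation error
of the actual Clifford+T circuit (`ApproxImplementation.abs_sum_normSq_sub_le_of_implOn`): Chebyshev
gives weight `≤ 32 prec²/K ≤ 1/6` to the bad event when `K ≥ 192 prec²`.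

## References

* D. Aharonov, V. Jones, Z. Landau, Algorithmica 55 (2009) = arXiv:quant-ph/0511096, §3.3,
  Claim 3.3 [AharonovJonesLandau2009].
* A. Yu. Kitaev, *Quantum measurements and the Abelian stabilizer problem*, 1995, §3 Lemma 9
  [Kitaev1995].
-/

noncomputable section

namespace Literature.Computability.QuantumComplexity

namespace AJLSampler

open Finset

variable {K : ℕ}

/-- **The bad event has weight at most `32 prec²/K`** (Chebyshev twice, union bound).
[cite: AharonovJonesLandau2009, Claim 3.3] [cite: Kitaev1995, §3 (Lemma 9)] -/
theorem pr_not_good_le_div {z : ℂ} (hz : ‖z‖ ≤ 1) {prec : ℕ} (hprec : 0 < prec) (hK : 0 < K) :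
    pr z (fun γ : Trial K → Bool => ¬ Good z prec K γ) ≤ 32 * (prec : ℝ) ^ 2 / K := by
  have hp' : (0 : ℝ) < prec := by exact_mod_cast hprec
  have hK' : (0 : ℝ) < K := by exact_mod_cast hK
  set a : ℝ := K / (8 * prec) with ha_def
  have ha : 0 < a := by positivity
  have hR := weight_deviation_le (K := K) hz false ha
  have hI := weight_deviation_le (K := K) hz true ha
  have hval : (K : ℝ) / (4 * a ^ 2) = 16 * prec ^ 2 / K := by
    rw [ha_def]; field_simp; ring
  rw [hval] at hR hI
  calc pr z (fun γ : Trial K → Bool => ¬ Good z prec K γ)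
      ≤ pr z (fun γ : Trial K → Bool => a ≤ |(count false γ : ℝ) - K * testProb z false true| ∨
          a ≤ |(count true γ : ℝ) - K * testProb z true true|) := by
        refine pr_mono hz fun γ hγ => ?_
        unfold Good at hγ
        rw [not_and_or, not_lt, not_lt] at hγ
        exact hγ
    _ ≤ 16 * prec ^ 2 / K + 16 * prec ^ 2 / K := (pr_or_le hz _ _).trans (add_le_add hR hI)
    _ = 32 * prec ^ 2 / K := by ring

/-- The bad event has weight `≤ 1/6` when `K ≥ 192 prec²`. [cite: AharonovJonesLandau2009, Claim 3.3] -/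
theorem pr_not_good_le_sixth {z : ℂ} (hz : ‖z‖ ≤ 1) {prec : ℕ} (hprec : 0 < prec) (hK : 192 * prec ^ 2 ≤ K) :
    pr z (fun γ : Trial K → Bool => ¬ Good z prec K γ) ≤ 1 / 6 := by
  have hKpos : 0 < K := by have : 0 < 192 * prec ^ 2 := by positivity
                           omega
  have hK' : (0 : ℝ) < K := by exact_mod_cast hKpos
  have hKr : (192 : ℝ) * prec ^ 2 ≤ K := by exact_mod_cast hK
  refine (pr_not_good_le_div hz hprec hKpos).trans ?_
  rw [div_le_div_iff₀ hK' (by norm_num : (0 : ℝ) < 6)]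
  linarith

/-- The good event has weight `≥ 5/6` when `K ≥ 192 prec²`. [cite: AharonovJonesLandau2009, Claim 3.3] -/
theorem pr_good_ge_five_sixths {z : ℂ} (hz : ‖z‖ ≤ 1) {prec : ℕ} (hprec : 0 < prec) (hK : 192 * prec ^ 2 ≤ K) :
    5 / 6 ≤ pr z (Good z prec K) := by
  have h1 := pr_add_pr_not (K := K) z (Good z prec K)
  have h2 := pr_not_good_le_sixth hz hprec hK
  linarith

/-- **Completeness with margin**: `|z| ≥ θ + 1/prec`, `K ≥ 192 prec²` ⇒ acceptance `≥ 5/6`.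
[cite: AharonovJonesLandau2009, §3.3, Claim 3.3 and Thm. 3.2] -/
theorem acceptProb_ge_of_yes' {z : ℂ} (hz : ‖z‖ ≤ 1) {θn θd prec K : ℕ} (hprec : 0 < prec)
    (hK : 192 * prec ^ 2 ≤ K) (hyes : (θn : ℝ) / θd + 1 / prec ≤ ‖z‖) :
    5 / 6 ≤ acceptProb z θn θd prec K := by
  have hp' : (0 : ℝ) < prec := by exact_mod_cast hprec
  have hKpos : 0 < K := by
    have : 0 < 192 * prec ^ 2 := by positivity
    omega
  refine (pr_good_ge_five_sixths hz hprec hK).trans (pr_mono hz fun γ hγ => ?_)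
  rw [accept_iff_le_norm]
  have hclose := norm_cEstimate_sub_lt hKpos hprec hγ.1 hγ.2
  have htri : ‖z‖ - ‖cEstimate K (count false γ) (count true γ)‖ ≤
      ‖cEstimate K (count false γ) (count true γ) - z‖ := by
    rw [← norm_neg (cEstimate K (count false γ) (count true γ) - z), neg_sub]
    exact norm_sub_norm_le _ _
  have h12 : (1 : ℝ) / prec - 1 / (2 * prec) = 1 / (2 * prec) := by field_simp; ring
  linarith

/-- **Soundness with margin**: `|z| ≤ θ`, `K ≥ 192 prec²` ⇒ acceptance `≤ 1/6`.
[cite: AharonovJonesLandau2009, §3.3, Claim 3.3 and Thm. 3.2] -/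
theorem acceptProb_le_of_no' {z : ℂ} (hz : ‖z‖ ≤ 1) {θn θd prec K : ℕ} (hprec : 0 < prec)
    (hK : 192 * prec ^ 2 ≤ K) (hno : ‖z‖ ≤ (θn : ℝ) / θd) :
    acceptProb z θn θd prec K ≤ 1 / 6 := by
  have hKpos : 0 < K := by
    have : 0 < 192 * prec ^ 2 := by positivity
    omega
  refine le_trans (pr_mono hz fun γ hγ => ?_) (pr_not_good_le_sixth hz hprec hK)
  intro hgood
  rw [accept_iff_le_norm] at hγ
  have hclose := norm_cEstimate_sub_lt hKpos hprec hgood.1 hgood.2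
  have htri : ‖cEstimate K (count false γ) (count true γ)‖ - ‖z‖ ≤
      ‖cEstimate K (count false γ) (count true γ) - z‖ := norm_sub_norm_le _ _
  linarith

end AJLSampler

end Literature.Computability.QuantumComplexity

end
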